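import Literature.AlgebraicGeometry.Motives.HodgeLieWeightOneLeviCompression
import Literature.AlgebraicGeometry.Motives.HodgeLieWeightOneLoweringCentralizer
import Literature.AlgebraicGeometry.Motives.HodgeThetaSubalgebraTensorSkeletonSegre
import Literature.AlgebraicGeometry.Motives.HodgeThetaSubalgebraUnitaryFourTwoSkeleton
import Literature.AlgebraicGeometry.Motives.HodgeThetaSubalgebraUnitaryFourTwoBlockUnits
import Mathlib.Tactic.Module
import HarnessLib

/-!
# Weight one, rank twelve: a minimal raising tripotent of rank `4` is impossible — the `2|4` Levi involution algebra
# dies by SEGRE COMPRESSION; the rank-twelve crux reduces to the `3|3` square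
# (Moonen–Zarhin 1999 (2.3)–(2.5), Deligne I §3; classification-free)

Family `hodge`, layer `Literature/AlgebraicGeometry/Motives`; THEOREMS ONLY (no definition, no named fact; D-0026).  Written for
the cell `pub-hodgeav-hg6` (LADDER-HodgeAV row 2, TABLE X row 1 `g6.I(1)`: the `r = 4` RETURN LEG of the rank-twelve programme
«`End⁰ = ℚ`, `g = 6` ⟹ `Hg = Sp₁₂`», eng-2 lineage g5, the assembly of bricks S (`SkeletonSegre.*`), C (`LeviCompression.*`),
T (`false_of_levi_commute_lowering_of_simple`) over N12 (`WeightOnePeirce.exists_leviInvolutionAlgebra`), V1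
(`UnitaryFourTwo.eq_top_of_annP_irreducible`), V3 (`UnitaryFourTwo.exists_matrix_units`), V3b (`UnitaryFourTwo.exists_block_units`);
honest framing: HC / HC_AV / HC_CM NOT proved, `Hg = Sp₁₂` NOT proved — the residual crux is the `3|3` square).

THE ARGUMENT (`WeightOnePeirce.false_of_minimal_rank_four`).  `H` effective polarized of weight one, `End_Hdg = ℚ`, `dim V = 12`,
`𝔥_ℂ` simple, `B` a minimal raising tripotent of rank `4`.  N12 gives the Levi involution algebra `(𝔏, T)` on `P = V^{1,0} ≅ ℂ⁶`
(`𝔏 = 𝔥⁰|_P ∋ 1`, irreducible, `T = 1 − 2E|_P`, `dim {T = 1} = 2`, `dim {T = −1} = 4`); `𝔏 ≠ End(P)` since `𝔏 = End(P)`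
would give `Lie Hg = 𝔰𝔭₁₂` (`SymplecticThetaTen.mem_spanC_of_skew_of_levi`) and a rank-one raising operator
(`leviAlgebra_ne_top`).  By V1 the `P_T`-annihilator ideal acts reducibly on `Q_T`, so V3 + V3b exhibit the TENSOR SKELETON:
`3 × 3` units `fᵢgⱼ ∈ 𝔏` and commuting `2 × 2` block units `P_ab ∈ 𝔏` with `tr(P₁₁E₁) = 1` (`P ≅ ℂ² ⊗ ℂ³`,
`𝔏 = 𝔤𝔩₂ ⊗ 1 + 1 ⊗ 𝔤𝔩₃`).  For a LOWERING `x ∈ 𝔥⁻`, with symmetric form `γ_x(p, p′) = ψ_ℂ(x p, p′)` on `P`, and idempotents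
`A₁ = fᵢgᵢ + c′fⱼgᵢ`, `A₂ = P_aa + cP_ba` of `𝔏` with Levi lifts `Z₁, Z₂ ∈ 𝔥⁰` (`LeviCompression.exists_levi_lift`), the
compression `Z₂Z₁xZ₁Z₂ ∈ 𝔥⁻` has its values on a line (`SkeletonSegre.exists_compression_eq_smul`), hence vanishes — a non-zero
lowering operator with values on a line would conjugate to a rank-one raising one (`lowering_eq_zero_of_line`) — so
`γ_x(A₁A₂ p, A₁A₂ p′) = 0` (`LeviCompression.form_compression_eq_zero`).  SEGRE VANISHING (`SkeletonSegre.form_offDiag_eq_zero`)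
then gives `γ_x(P₁₂ p, p′) + γ_x(p, P₁₂ p′) = 0`, i.e. the Levi lift `Z` of `P₁₂ ≠ 0` commutes with `x`
(`LeviCompression.commute_of_form`).  A non-zero Levi element commuting with all lowering operators contradicts simplicity
(`false_of_levi_commute_lowering_of_simple`, trace form + N15).

* §1 `WeightOnePeirce.leviAlgebra_ne_top`, `WeightOnePeirce.lowering_eq_zero_of_line` (the two uses of minimality).
* §2 **`WeightOnePeirce.false_of_minimal_rank_four`** — THE `r = 4` KILL.
* §3 **`rankTwelve_sp_or_simple_three`**, **`rankTwelve_sp_or_leviCore33`** — the rank-twelve dispatch after this file: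
  `dim_ℚ V = 12`, `End_Hdg = ℚ` ⟹ `Lie Hg = 𝔰𝔭₁₂`, OR `𝔥_ℂ` is simple with a minimal raising tripotent of rank EXACTLY `3`,
  equivalently with a PROPER Levi involution algebra of type `3|3` on `V^{1,0} ≅ ℂ⁶` (the residual crux: the `3|3` square).

## References

* [MoonenZarhin1999LowDim] B. Moonen, Yu. Zarhin, *Hodge classes on abelian varieties of low dimension*, Math. Ann. 315 (1999),
  §2 (2.3)–(2.5), Thm. (2.7).
* [Deligne1982HodgeCycles] P. Deligne, *Hodge cycles on abelian varieties*, LNM 900 (1982), I §3 (Prop. 3.4, 3.6).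
* [Ribet1983] K. Ribet, *Hodge classes on certain types of abelian varieties*, Amer. J. Math. 105 (1983), Thm. 3.
* [FultonHarrisGTM129] W. Fulton, J. Harris, *Representation Theory*, §6.1, Exercise 6.11.
-/

noncomputable section

open scoped TensorProduct

open Module

namespace Literature.AlgebraicGeometry.Motives

namespace HodgeStructure

universe u

variable {V : Type u} [AddCommGroup V] [Module ℚ V] [Module.Finite ℚ V] [HodgeTensorFacts.{u, u}] {n : ℤ}

/-! ## §1 The two uses of minimality -/

set_option maxHeartbeats 1600000 in
/-- **A Levi algebra of restrictions is proper when the minimal raising rank is `≥ 2`.**  `H` effective polarized of weight `1`,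
`End_Hdg = ℚ`; `B` raising with values in `P` whose rank is minimal among the non-zero raising operators of `𝔥_ℂ` and `≥ 2`;
`𝔏 ⊆ End(P)` any subspace whose members are restrictions of elements of `𝔥_ℂ`.  Then `𝔏 ≠ ⊤`: otherwise every element of
`End(P)` is a restriction, `Lie Hg ⊗ ℂ = 𝔰𝔭` (`SymplecticThetaTen.mem_spanC_of_skew_of_levi`) contains the rank-one raising
operator `ψ_ℂ(·, p₀) p₀`, contradicting minimality (the argument of N12 §2).
[cite: MoonenZarhin1999LowDim, §2 (2.3)–(2.5)] [cite: Deligne1982HodgeCycles, I §3 Prop. 3.4, Prop. 3.6] -/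
theorem WeightOnePeirce.leviAlgebra_ne_top (H : HodgeStructure V n) (ψ : H.Polarization) (hn : n = 1)
    (heff : H.IsEffective) (hE : ∀ a ∈ H.endAlg, ∃ x : ℚ, a = x • (1 : Module.End ℚ V))
    {B : Module.End ℂ (ℂ ⊗[ℚ] V)} (hBim : ∀ v, B v ∈ H.piece 1 0)
    (hmin : ∀ B' ∈ H.hodgeLieC, B' ≠ 0 → (∀ p ∈ H.piece 1 0, B' p = 0) → (∀ v, B' v ∈ H.piece 1 0) →
      Module.finrank ℂ (LinearMap.range B) ≤ Module.finrank ℂ (LinearMap.range B'))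
    (h2 : 2 ≤ Module.finrank ℂ (LinearMap.range B))
    {𝔏 : Submodule ℂ (Module.End ℂ ↥(H.piece 1 0))}
    (hmem𝔏 : ∀ A, A ∈ 𝔏 → ∃ Z ∈ H.hodgeLieC, ∀ p : ↥(H.piece 1 0), ((A p : ↥(H.piece 1 0)) : ℂ ⊗[ℚ] V) = Z p) :
    𝔏 ≠ ⊤ := by
  classical
  obtain ⟨hbr, hskew, -, Θ, hΘ, hΘ𝔤⟩ := hodgeLie_standing H ψ
  have hspan : H.hodgeLieC = spanC H.hodgeLie := hodgeLieC_eq_spanC H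
  intro htop
  have hP0 : H.piece 1 0 ≠ ⊥ := fun h => by
    have hle : LinearMap.range B ≤ H.piece 1 0 := by
      rintro _ ⟨w, rfl⟩
      exact hBim w
    rw [h, le_bot_iff] at hle
    rw [hle, finrank_bot] at h2
    omega
  have hlevi : ∀ A : Module.End ℂ ↥(H.piece 1 0), ∃ Z ∈ spanC H.hodgeLie, ∀ p : ↥(H.piece 1 0),
      ((A p : ↥(H.piece 1 0)) : ℂ ⊗[ℚ] V) = Z p := fun A => by
    obtain ⟨Z, hZ, hAZ⟩ := hmem𝔏 A (htop ▸ Submodule.mem_top)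
    exact ⟨Z, hspan ▸ hZ, hAZ⟩
  have hall := fun (Y : Module.End ℂ (ℂ ⊗[ℚ] V))
      (hY : ∀ x y, ψ.form.baseChange ℂ (Y x) y + ψ.form.baseChange ℂ x (Y y) = 0) =>
    SymplecticThetaTen.mem_spanC_of_skew_of_levi H hn heff ψ hE H.hodgeLie hbr hΘ hΘ𝔤 hskew hP0 hlevi hY
  -- a rank-one raising `ψ_ℂ`-skew operator `Y v = ψ_ℂ(v, p₀) p₀` (adapted from N12 §2)
  subst hn
  obtain ⟨p₀, hp₀P, hp₀0⟩ := (Submodule.ne_bot_iff _).1 hP0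
  set ω := ψ.form.baseChange ℂ with hω
  have hωalt : ∀ x x', ω x x' = -ω x' x := fun x x' => by rw [hω, form_baseChange_swap_of_odd H odd_one ψ x' x]
  have hωnd : ω.Nondegenerate := by rw [hω]; exact ψ.nondegenerate_baseChange
  have hPP : ∀ p ∈ H.piece 1 0, ∀ p' ∈ H.piece 1 0, ω p p' = 0 := fun p hp p' hp' =>
    ψ.form_piece_piece (p := 1) (p' := 1) (by norm_num) (by rw [sub_self]; exact hp) (by rw [sub_self]; exact hp')
  let Y : Module.End ℂ (ℂ ⊗[ℚ] V) := (ω.flip p₀).smulRight p₀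
  have hYv : ∀ v, Y v = ω v p₀ • p₀ := fun v => rfl
  have hYskew : ∀ x y, ω (Y x) y + ω x (Y y) = 0 := fun x y => by
    rw [hYv, hYv, map_smul, LinearMap.smul_apply, map_smul, smul_eq_mul, smul_eq_mul, hωalt p₀ y]
    ring
  have hY𝔥 : Y ∈ H.hodgeLieC := by rw [hspan]; exact hall Y hYskew
  have hYP : ∀ p ∈ H.piece 1 0, Y p = 0 := fun p hp => by rw [hYv, hPP p hp p₀ hp₀P, zero_smul]
  have hYim : ∀ v, Y v ∈ H.piece 1 0 := fun v => by rw [hYv]; exact Submodule.smul_mem _ _ hp₀P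
  have hY0 : Y ≠ 0 := by
    intro h0
    obtain ⟨v, hv⟩ : ∃ v, ω v p₀ ≠ 0 := by
      by_contra hno
      push Not at hno
      apply hp₀0
      refine hωnd.1 _ fun w => ?_
      rw [hωalt, hno w, neg_zero]
    have h := congrArg (fun X : Module.End ℂ (ℂ ⊗[ℚ] V) => X v) h0
    simp only [hYv, LinearMap.zero_apply, smul_eq_zero] at h
    rcases h with h | h
    · exact hv h
    · exact hp₀0 h
  have hYrk : Module.finrank ℂ (LinearMap.range Y) ≤ 1 := by
    have hle : LinearMap.range Y ≤ Submodule.span ℂ ({p₀} : Set (ℂ ⊗[ℚ] V)) := by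
      rintro _ ⟨v, rfl⟩
      rw [hYv]
      exact Submodule.smul_mem _ _ (Submodule.mem_span_singleton_self p₀)
    exact (Submodule.finrank_mono hle).trans ((finrank_span_le_card _).trans (by simp))
  have h := hmin Y hY𝔥 hY0 hYP hYim
  omega

set_option maxHeartbeats 800000 in
/-- **No non-zero lowering operator has its values on a line** when the minimal raising rank is `≥ 2`: conjugating such a
`y ∈ 𝔥⁻` gives a raising `ȳ ∈ 𝔥_ℂ` of rank `≤ 1`. [cite: Deligne1982HodgeCycles, I §3 Prop. 3.4]
[cite: MoonenZarhin1999LowDim, §2 (2.3)] -/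
theorem WeightOnePeirce.lowering_eq_zero_of_line (H : HodgeStructure V n) (hn : n = 1)
    {B : Module.End ℂ (ℂ ⊗[ℚ] V)}
    (hmin : ∀ B' ∈ H.hodgeLieC, B' ≠ 0 → (∀ p ∈ H.piece 1 0, B' p = 0) → (∀ v, B' v ∈ H.piece 1 0) →
      Module.finrank ℂ (LinearMap.range B) ≤ Module.finrank ℂ (LinearMap.range B'))
    (h2 : 2 ≤ Module.finrank ℂ (LinearMap.range B))
    {y : Module.End ℂ (ℂ ⊗[ℚ] V)} (hy : y ∈ H.hodgeLieC) (hyQ : ∀ q ∈ H.piece 0 1, y q = 0)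
    (hyim : ∀ v, y v ∈ H.piece 0 1) (v₀ : ℂ ⊗[ℚ] V) (hline : ∀ v, ∃ t : ℂ, y v = t • v₀) : y = 0 := by
  classical
  by_contra hy0
  have hspan : H.hodgeLieC = spanC H.hodgeLie := hodgeLieC_eq_spanC H
  obtain ⟨yb, hyb⟩ := exists_conjOp y
  have hyb𝔥 : yb ∈ H.hodgeLieC := by
    rw [hspan] at hy ⊢
    exact conjOp_mem_spanC hy hyb
  subst hn
  have hybP : ∀ p ∈ H.piece 1 0, yb p = 0 := fun p hp => by
    rw [hyb, hyQ _ (conj_mem_piece H hp), map_zero]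
  have hybim : ∀ v, yb v ∈ H.piece 1 0 := fun v => by
    rw [hyb]
    exact conj_mem_piece H (hyim _)
  have hyb0 : yb ≠ 0 := by
    intro h
    apply hy0
    refine LinearMap.ext fun v => ?_
    have e := hyb (conj v)
    rw [h, LinearMap.zero_apply, conj_conj] at e
    have e' := congrArg conj e
    rw [map_zero, conj_conj] at e'
    rw [LinearMap.zero_apply]
    exact e'.symm
  have hle : LinearMap.range yb ≤ Submodule.span ℂ ({conj v₀} : Set (ℂ ⊗[ℚ] V)) := by
    rintro _ ⟨v, rfl⟩
    obtain ⟨t, ht⟩ := hline (conj v)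
    rw [hyb, ht, conj_smul]
    exact Submodule.smul_mem _ _ (Submodule.mem_span_singleton_self _)
  have hrk : Module.finrank ℂ (LinearMap.range yb) ≤ 1 :=
    (Submodule.finrank_mono hle).trans ((finrank_span_le_card _).trans (by simp))
  have h := hmin yb hyb𝔥 hyb0 hybP hybim
  omega

/-! ## §2 The `r = 4` kill -/

set_option maxHeartbeats 6400000 in
/-- **A minimal raising tripotent of rank `4` is impossible (rank twelve, `End_Hdg = ℚ`, `𝔥_ℂ` simple).**  See the module
docstring for the argument (N12 Levi involution algebra of type `2|4`; V1/V3/V3b tensor skeleton; Levi compression of lowering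
operators; Segre vanishing; the lift of the block unit `P₁₂` commutes with `𝔥⁻`; trace-form contradiction).
[cite: MoonenZarhin1999LowDim, §2 (2.3)–(2.5), Thm. (2.7)] [cite: Deligne1982HodgeCycles, I §3 Prop. 3.4, Prop. 3.6]
[cite: Ribet1983, Thm. 3] [cite: FultonHarrisGTM129, §6.1 Exercise 6.11] -/
theorem WeightOnePeirce.false_of_minimal_rank_four (H : HodgeStructure V n) (ψ : H.Polarization) (hn : n = 1)
    (heff : H.IsEffective) (hE : ∀ a ∈ H.endAlg, ∃ x : ℚ, a = x • (1 : Module.End ℚ V))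
    (hV : Module.finrank ℚ V = 12)
    (hsimple : ∀ T : Submodule ℂ (Module.End ℂ (ℂ ⊗[ℚ] V)), T ≤ H.hodgeLieC → T ≠ ⊥ →
      (∀ Y ∈ H.hodgeLieC, ∀ t ∈ T, Y * t - t * Y ∈ T) → T = H.hodgeLieC)
    {B C : Module.End ℂ (ℂ ⊗[ℚ] V)} (hB : B ∈ H.hodgeLieC) (hB0 : B ≠ 0) (hBP : ∀ p ∈ H.piece 1 0, B p = 0)
    (hBim : ∀ v, B v ∈ H.piece 1 0) (hC : ∀ v, C v = conj (B (conj v)))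
    (hmin : ∀ B' ∈ H.hodgeLieC, B' ≠ 0 → (∀ p ∈ H.piece 1 0, B' p = 0) → (∀ v, B' v ∈ H.piece 1 0) →
      Module.finrank ℂ (LinearMap.range B) ≤ Module.finrank ℂ (LinearMap.range B'))
    (h4 : Module.finrank ℂ (LinearMap.range B) = 4) : False := by
  classical
  obtain ⟨hbr, hskew, -, Θ, hΘ, hΘ𝔤⟩ := hodgeLie_standing H ψ
  have hspan : H.hodgeLieC = spanC H.hodgeLie := hodgeLieC_eq_spanC H
  have hΘC : Θ ∈ H.hodgeLieC := by rw [hspan]; exact hΘ𝔤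
  have hbrC : ∀ Y ∈ H.hodgeLieC, ∀ Z ∈ H.hodgeLieC, Y * Z - Z * Y ∈ H.hodgeLieC := fun Y hY Z hZ => by
    rw [hspan] at hY hZ ⊢
    exact commutator_mem_spanC hbr hY hZ
  have hirr : ∀ U : Submodule ℂ (ℂ ⊗[ℚ] V), (∀ Z ∈ H.hodgeLieC, ∀ u ∈ U, Z u ∈ U) → U = ⊥ ∨ U = ⊤ :=
    fun U hU => SymplecticTheta.eq_bot_or_top_of_stable H hn heff ψ hE H.hodgeLie hΘ hΘ𝔤 hskew
      fun X hX u hu => hU _ (by rw [hspan]; exact baseChange_mem_spanC hX) u hu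
  have hC𝔊 : C ∈ H.hodgeLieC := by
    rw [hspan] at hB ⊢
    exact conjOp_mem_spanC hB hC
  obtain ⟨hP6, -⟩ := finrank_pieces_eq_of_weightOne H hn heff (m := 6) (by rw [hV]) hΘ
  have h2 : 2 ≤ Module.finrank ℂ (LinearMap.range B) := by omega
  have hnoline : ∀ y ∈ H.hodgeLieC, (∀ q ∈ H.piece 0 1, y q = 0) → (∀ v, y v ∈ H.piece 0 1) →
      ∀ v₀ : ℂ ⊗[ℚ] V, (∀ v, ∃ t : ℂ, y v = t • v₀) → y = 0 := fun y hy hyQ hyim v₀ hl =>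
    WeightOnePeirce.lowering_eq_zero_of_line H hn hmin h2 hy hyQ hyim v₀ hl
  -- the Levi involution algebra of type `2|4`
  obtain ⟨𝔏, T, PT, QT, hmem𝔏, h𝔏br, h𝔏one, h𝔏irr, hT𝔏, hTT, hPT, hQT, -, hfinQT, hsum⟩ :=
    WeightOnePeirce.exists_leviInvolutionAlgebra H ψ hn heff hΘ le_rfl hbrC hΘC hirr hB hB0 hBP hBim hC hC𝔊 hmin
  have hne : 𝔏 ≠ ⊤ :=
    WeightOnePeirce.leviAlgebra_ne_top H ψ hn heff hE hBim hmin h2 (𝔏 := 𝔏) fun A hA => (hmem𝔏 A).1 hA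
  have hQT4 : Module.finrank ℂ QT = 4 := by rw [hfinQT, h4]
  have hPT2 : Module.finrank ℂ PT = 2 := by omega
  subst hn
  -- Levi lifts of the elements of `𝔏`
  have hlift : ∀ A ∈ 𝔏, ∃ Z ∈ H.hodgeLieC, (∀ p : ↥(H.piece 1 0), Z (p : ℂ ⊗[ℚ] V) = ((A p : ↥(H.piece 1 0)) : ℂ ⊗[ℚ] V)) ∧
      (∀ p ∈ H.piece 1 0, Z p ∈ H.piece 1 0) ∧ (∀ q ∈ H.piece 0 1, Z q ∈ H.piece 0 1) := by
    intro A hA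
    obtain ⟨Z', hZ', hAZ'⟩ := (hmem𝔏 A).1 hA
    have hZ'P : ∀ p ∈ H.piece 1 0, Z' p ∈ H.piece 1 0 := fun p hp => by
      have h := (A ⟨p, hp⟩).2
      rw [hAZ' ⟨p, hp⟩] at h
      exact h
    obtain ⟨Z, hZ, hZZ', hZP, hZQ⟩ := LeviCompression.exists_levi_lift H ψ rfl heff hZ' hZ'P
    exact ⟨Z, hZ, fun p => by rw [hZZ' _ p.2]; exact (hAZ' p).symm, hZP, hZQ⟩
  -- (i) the `P_T`-annihilator ideal acts reducibly on `Q_T` (else `𝔏 = ⊤` by V1)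
  have hNred : ∃ U₀ : Submodule ℂ ↥(H.piece 1 0), U₀ ≤ QT ∧ U₀ ≠ ⊥ ∧ U₀ ≠ QT ∧
      ∀ X ∈ 𝔏, X * T = T * X → (∀ p ∈ PT, X p = 0) → ∀ y ∈ U₀, X y ∈ U₀ := by
    by_contra hno
    apply hne
    refine UnitaryFourTwo.eq_top_of_annP_irreducible h𝔏br h𝔏one h𝔏irr hT𝔏 hTT hPT hQT hPT2 (by omega)
      fun U hU hUst => ?_
    by_contra hU'
    exact hno ⟨U, hU, fun h => hU' (Or.inl h), fun h => hU' (Or.inr h), hUst⟩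
  -- (ii) the tensor skeleton (V3) and its block units (V3b)
  obtain ⟨e, Cu, E₁, E₂, U, Vu, ⟨he, hCu, hE₁, hE₂, hU, hVu, heU, hVuC⟩,
    ⟨hCe, hCE₁, hCV, hE₁e, hE₁E₁, hE₁V, hUe, hUE₁, hUV⟩, ⟨heE₁, hVE₁, hE₁C, hE₁U, hVU, hunits, -, hr₁⟩, -, hfull⟩ :=
    UnitaryFourTwo.exists_matrix_units h𝔏br h𝔏one h𝔏irr hT𝔏 hTT hPT hQT hPT2 hQT4 hNred
  have hunits' : e * Cu + E₁ + Vu * U = 1 := by rw [hVU]; exact hunits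
  obtain ⟨P₁₁, P₁₂, P₂₁, P₂₂, ⟨hP₁₁, hP₁₂, hP₂₁, hP₂₂⟩, hPcomm,
    ⟨h1111, h1112, h1221, h1222, h2111, h2112, h2221, h2222⟩,
    ⟨h1121, h1122, h1211, h1212, h2121, h2122, h2211, h2212⟩, hPsum, htr, -⟩ :=
    UnitaryFourTwo.exists_block_units heE₁ hVE₁ hE₁C hE₁U hE₁E₁ hunits' hr₁ hfull
  obtain ⟨h11e, h11C, h11E, h11U, h11V⟩ := hPcomm P₁₁ (by simp)
  obtain ⟨h12e, h12C, h12E, h12U, h12V⟩ := hPcomm P₁₂ (by simp)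
  obtain ⟨h21e, h21C, h21E, h21U, h21V⟩ := hPcomm P₂₁ (by simp)
  obtain ⟨h22e, h22C, h22E, h22U, h22V⟩ := hPcomm P₂₂ (by simp)
  -- `Fin`-indexed families for the Segre brick
  let f : Fin 3 → Module.End ℂ ↥(H.piece 1 0) := ![e, E₁, Vu]
  let g : Fin 3 → Module.End ℂ ↥(H.piece 1 0) := ![Cu, E₁, U]
  let p : Fin 2 → Fin 2 → Module.End ℂ ↥(H.piece 1 0) := ![![P₁₁, P₁₂], ![P₂₁, P₂₂]]
  have hf0 : f 0 = e := rfl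
  have hf1 : f 1 = E₁ := rfl
  have hf2 : f 2 = Vu := rfl
  have hg0 : g 0 = Cu := rfl
  have hg1 : g 1 = E₁ := rfl
  have hg2 : g 2 = U := rfl
  have hp00 : p 0 0 = P₁₁ := rfl
  have hp01 : p 0 1 = P₁₂ := rfl
  have hp10 : p 1 0 = P₂₁ := rfl
  have hp11 : p 1 1 = P₂₂ := rfl
  have hpp : ∀ a b d, p a b * p b d = p a d := by
    intro a b d
    fin_cases a <;> fin_cases b <;> fin_cases d <;>
      first
      | exact h1111 | exact h1112 | exact h1221 | exact h1222 | exact h2111 | exact h2112 | exact h2221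
      | exact h2222
  have hpp0 : ∀ a b c d, b ≠ c → p a b * p c d = 0 := by
    intro a b c d hbc
    fin_cases a <;> fin_cases b <;> fin_cases c <;> fin_cases d <;>
      first
      | exact (hbc rfl).elim
      | exact h1121 | exact h1122 | exact h1211 | exact h1212 | exact h2121 | exact h2122 | exact h2211
      | exact h2212
  have hp1 : p 0 0 + p 1 1 = 1 := by rw [hp00, hp11]; exact hPsum
  have hgf : ∀ j, g j * f j = E₁ := by
    intro j
    fin_cases j <;> first | exact hCe | exact hE₁E₁ | exact hUV
  have hgf0 : ∀ j k, j ≠ k → g j * f k = 0 := by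
    intro j k hjk
    fin_cases j <;> fin_cases k <;>
      first
      | exact (hjk rfl).elim
      | exact hCE₁ | exact hCV | exact hE₁e | exact hE₁V | exact hUe | exact hUE₁
  have hEg : ∀ j, E₁ * g j = g j := by
    intro j
    fin_cases j <;> first | exact hE₁C | exact hE₁E₁ | exact hE₁U
  have hsum' : f 0 * g 0 + f 1 * g 1 + f 2 * g 2 = 1 := by
    rw [hf0, hf1, hf2, hg0, hg1, hg2, hE₁E₁]
    exact hunits'
  have hpf : ∀ a b i, p a b * f i = f i * p a b := by
    intro a b i
    fin_cases a <;> fin_cases b <;> fin_cases i <;>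
      first
      | exact h11e | exact h11E | exact h11V | exact h12e | exact h12E | exact h12V | exact h21e | exact h21E
      | exact h21V | exact h22e | exact h22E | exact h22V
  have hpg : ∀ a b j, p a b * g j = g j * p a b := by
    intro a b j
    fin_cases a <;> fin_cases b <;> fin_cases j <;>
      first
      | exact h11C | exact h11E | exact h11U | exact h12C | exact h12E | exact h12U | exact h21C | exact h21E
      | exact h21U | exact h22C | exact h22E | exact h22U
  -- memberships in `𝔏`
  have heC𝔏 : e * Cu ∈ 𝔏 := by
    have h : e * Cu = 1 + (-1 : ℂ) • E₁ + (-1 : ℂ) • E₂ := by rw [← hunits]; module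
    rw [h]
    exact 𝔏.add_mem (𝔏.add_mem h𝔏one (𝔏.smul_mem _ hE₁)) (𝔏.smul_mem _ hE₂)
  have heE₁𝔏 : e * E₁ ∈ 𝔏 := by rw [heE₁]; exact he
  have hE₁C𝔏 : E₁ * Cu ∈ 𝔏 := by rw [hE₁C]; exact hCu
  have hE₁E₁𝔏 : E₁ * E₁ ∈ 𝔏 := by rw [hE₁E₁]; exact hE₁
  have hE₁U𝔏 : E₁ * U ∈ 𝔏 := by rw [hE₁U]; exact hU
  have hVE₁𝔏 : Vu * E₁ ∈ 𝔏 := by rw [hVE₁]; exact hVu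
  have hVU𝔏 : Vu * U ∈ 𝔏 := by rw [hVU]; exact hE₂
  have hfg𝔏 : ∀ i j, f i * g j ∈ 𝔏 := by
    intro i j
    fin_cases i <;> fin_cases j <;>
      first
      | exact heC𝔏 | exact heE₁𝔏 | exact heU | exact hE₁C𝔏 | exact hE₁E₁𝔏 | exact hE₁U𝔏 | exact hVuC
      | exact hVE₁𝔏 | exact hVU𝔏
  have hp𝔏 : ∀ a b, p a b ∈ 𝔏 := by
    intro a b
    fin_cases a <;> fin_cases b <;> first | exact hP₁₁ | exact hP₁₂ | exact hP₂₁ | exact hP₂₂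
  -- unit products
  have huu : ∀ i j l, f i * g j * (f j * g l) = f i * g l := SkeletonSegre.unit_mul_unit hgf hEg
  have huu0 : ∀ i j k l, j ≠ k → f i * g j * (f k * g l) = 0 := fun i j k l hjk => by
    rw [mul_assoc, ← mul_assoc (g j), hgf0 j k hjk, zero_mul, mul_zero]
  -- (iii) the one-dimensional multiplicity line: `rank(P₁₁ E₁) = 1`
  have hidem : IsIdempotentElem (P₁₁ * E₁) := by
    change P₁₁ * E₁ * (P₁₁ * E₁) = P₁₁ * E₁
    rw [mul_assoc, ← mul_assoc E₁ P₁₁ E₁, ← h11E, mul_assoc, hE₁E₁, ← mul_assoc, h1111]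
  haveI : Module.Free ℂ ↥(LinearMap.range (P₁₁ * E₁)) :=
    Module.Free.of_divisionRing (K := ℂ) (V := ↥(LinearMap.range (P₁₁ * E₁)))
  haveI : Module.Free ℂ ↥(LinearMap.ker (P₁₁ * E₁)) :=
    Module.Free.of_divisionRing (K := ℂ) (V := ↥(LinearMap.ker (P₁₁ * E₁)))
  have hrank1 : Module.finrank ℂ ↥(LinearMap.range (P₁₁ * E₁)) = 1 := by
    have h := ((LinearMap.isProj_range_iff_isIdempotentElem (P₁₁ * E₁)).2 hidem).trace
    rw [htr] at h
    exact_mod_cast h.symm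
  obtain ⟨w₀, -, hw₀⟩ := (finrank_eq_one_iff' (K := ℂ) (V := ↥(LinearMap.range (P₁₁ * E₁)))).1 hrank1
  have hline : ∀ y : ↥(H.piece 1 0), ∃ t : ℂ, (p 0 0 * (f 1 * g 1)) y = t • (w₀ : ↥(H.piece 1 0)) := fun y => by
    obtain ⟨c, hc⟩ := hw₀ ⟨(P₁₁ * E₁) y, LinearMap.mem_range_self _ y⟩
    refine ⟨c, ?_⟩
    have h := congrArg Subtype.val hc
    simp only [Submodule.coe_smul] at h
    rw [hp00, hf1, hg1, hE₁E₁, ← h]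
  let m : Fin 2 → Fin 3 → ↥(H.piece 1 0) := fun a i => (p a 0 * (f i * g 1)) (w₀ : ↥(H.piece 1 0))
  have hm : ∀ a i, m a i = (p a 0 * (f i * g 1)) (w₀ : ↥(H.piece 1 0)) := fun _ _ => rfl
  -- (iv) the Levi lift of the block unit `P₁₂`
  obtain ⟨Z, hZ, hZv, hZP, hZQ⟩ := hlift P₁₂ hP₁₂
  have hP₁₁0 : P₁₁ ≠ 0 := fun h => by
    rw [h, zero_mul, map_zero] at htr
    exact zero_ne_one htr
  have hP₁₂0 : P₁₂ ≠ 0 := fun h => hP₁₁0 (by rw [← h1221, h, zero_mul])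
  have hZ0 : Z ≠ 0 := by
    intro h
    apply hP₁₂0
    refine LinearMap.ext fun q => Subtype.ext ?_
    rw [← hZv q, h, LinearMap.zero_apply, LinearMap.zero_apply, Submodule.coe_zero]
  -- (v) `Z` commutes with every lowering operator
  have hcomm : ∀ x ∈ H.hodgeLieC, (∀ q ∈ H.piece 0 1, x q = 0) → (∀ v, x v ∈ H.piece 0 1) → Z * x = x * Z := by
    intro x hx hxQ hxim
    -- the symmetric form `γ_x` on `P`
    let γ : ↥(H.piece 1 0) →ₗ[ℂ] ↥(H.piece 1 0) →ₗ[ℂ] ℂ := (ψ.form.baseChange ℂ).compl₁₂ (x ∘ₗ (H.piece 1 0).subtype) (H.piece 1 0).subtype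
    have hγv : ∀ y y' : ↥(H.piece 1 0), γ y y' = ψ.form.baseChange ℂ (x y) y' := fun _ _ => rfl
    have hγ : ∀ y y', γ y y' = γ y' y := fun y y' => by
      rw [hγv, hγv, formBaseChange_skew_of_mem_hodgeLieC ψ hx (y : ℂ ⊗[ℚ] V) y',
        form_baseChange_swap_of_odd H odd_one ψ (x y') y, neg_neg]
    -- vanishing of all decomposable compressions
    have hvan : ∀ (a b : Fin 2) (i j : Fin 3) (c c' : ℂ), a ≠ b → i ≠ j → ∀ y y',
        γ (((f i * g i + c' • (f j * g i)) * (p a a + c • p b a)) y)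
          (((f i * g i + c' • (f j * g i)) * (p a a + c • p b a)) y') = 0 := by
      intro a b i j c c' hab hij y y'
      have hRline := fun y : ↥(H.piece 1 0) =>
        SkeletonSegre.exists_compression_eq_smul hpp hgf hEg hpf hpg hline hm a b i j c c' y
      set A₁ : Module.End ℂ ↥(H.piece 1 0) := f i * g i + c' • (f j * g i) with hA₁
      set A₂ : Module.End ℂ ↥(H.piece 1 0) := p a a + c • p b a with hA₂
      have hA₁𝔏 : A₁ ∈ 𝔏 := Submodule.add_mem _ (hfg𝔏 i i) (Submodule.smul_mem _ _ (hfg𝔏 j i))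
      have hA₂𝔏 : A₂ ∈ 𝔏 := Submodule.add_mem _ (hp𝔏 a a) (Submodule.smul_mem _ _ (hp𝔏 b a))
      have hA₁A₁ : A₁ * A₁ = A₁ := by
        rw [hA₁, add_mul, mul_add, mul_add, smul_mul_assoc, mul_smul_comm, smul_mul_assoc, mul_smul_comm,
          huu i i i, huu0 i i j i hij, huu j i i, huu0 j i j i hij, smul_zero, add_zero, smul_zero, add_zero]
      have hA₂A₂ : A₂ * A₂ = A₂ := by
        rw [hA₂, add_mul, mul_add, mul_add, smul_mul_assoc, mul_smul_comm, smul_mul_assoc, mul_smul_comm,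
          hpp a a a, hpp0 a a b a hab, hpp b a a, hpp0 b a b a hab, smul_zero, add_zero, smul_zero, add_zero]
      obtain ⟨Z₁, hZ₁, hZ₁v, hZ₁P, hZ₁Q⟩ := hlift A₁ hA₁𝔏
      obtain ⟨Z₂, hZ₂, hZ₂v, hZ₂P, hZ₂Q⟩ := hlift A₂ hA₂𝔏
      have hZ₁Z₁ : ∀ q ∈ H.piece 1 0, Z₁ (Z₁ q) = Z₁ q := fun q hq => by
        rw [show Z₁ q = ((A₁ ⟨q, hq⟩ : ↥(H.piece 1 0)) : ℂ ⊗[ℚ] V) from hZ₁v ⟨q, hq⟩, hZ₁v (A₁ ⟨q, hq⟩)]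
        change (((A₁ * A₁) ⟨q, hq⟩ : ↥(H.piece 1 0)) : ℂ ⊗[ℚ] V) = _
        rw [hA₁A₁]
      have hZ₂Z₂ : ∀ q ∈ H.piece 1 0, Z₂ (Z₂ q) = Z₂ q := fun q hq => by
        rw [show Z₂ q = ((A₂ ⟨q, hq⟩ : ↥(H.piece 1 0)) : ℂ ⊗[ℚ] V) from hZ₂v ⟨q, hq⟩, hZ₂v (A₂ ⟨q, hq⟩)]
        change (((A₂ * A₂) ⟨q, hq⟩ : ↥(H.piece 1 0)) : ℂ ⊗[ℚ] V) = _
        rw [hA₂A₂]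
      have hcomp : ∀ y : ↥(H.piece 1 0), Z₁ (Z₂ (y : ℂ ⊗[ℚ] V)) = (((A₁ * A₂) y : ↥(H.piece 1 0)) : ℂ ⊗[ℚ] V) := fun y => by
        rw [hZ₂v y, hZ₁v (A₂ y)]
        rfl
      have hline' : ∀ q ∈ H.piece 1 0, ∃ t : ℂ, Z₁ (Z₂ q) = t • (((A₁ * A₂) (m a i) : ↥(H.piece 1 0)) : ℂ ⊗[ℚ] V) := fun q hq => by
        obtain ⟨t, ht⟩ := hRline ⟨q, hq⟩
        refine ⟨t, ?_⟩
        rw [show Z₁ (Z₂ q) = (((A₁ * A₂) ⟨q, hq⟩ : ↥(H.piece 1 0)) : ℂ ⊗[ℚ] V) from hcomp ⟨q, hq⟩, ht, Submodule.coe_smul]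
      have hcz := LeviCompression.form_compression_eq_zero H ψ rfl heff hnoline hZ₁ hZ₂ hZ₁P hZ₁Q hZ₂P hZ₂Q
        hZ₁Z₁ hZ₂Z₂ hline' hx hxQ hxim
      rw [hγv, ← hcomp y, ← hcomp y']
      exact hcz _ y.2 _ y'.2
    -- Segre vanishing for the block unit `P₁₂ = p 0 1`, then the commutator criterion
    have hseg := SkeletonSegre.form_offDiag_eq_zero hpp hpp0 hp1 hgf hEg hsum' hpf hpg hline hm hγ hvan
      (a₁ := 0) (a₂ := 1) (by decide)
    refine LeviCompression.commute_of_form H ψ rfl heff hZ hZP hZQ hxQ hxim fun q hq q' hq' => ?_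
    have h := hseg ⟨q, hq⟩ ⟨q', hq'⟩
    rw [hγv, hγv] at h
    have e1 : (((p 0 1) ⟨q, hq⟩ : ↥(H.piece 1 0)) : ℂ ⊗[ℚ] V) = Z q := (hZv ⟨q, hq⟩).symm
    have e2 : (((p 0 1) ⟨q', hq'⟩ : ↥(H.piece 1 0)) : ℂ ⊗[ℚ] V) = Z q' := (hZv ⟨q', hq'⟩).symm
    rw [e1, e2] at h
    exact h
  exact false_of_levi_commute_lowering_of_simple H ψ rfl heff hsimple hB hB0 hBP hBim hZ hZ0 hZP hZQ hcomm

/-! ## §3 The rank-twelve dispatch after the `r = 4` kill -/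

set_option maxHeartbeats 800000 in
/-- **Rank twelve, `End_Hdg = ℚ`: either `Lie Hg ⊗ ℂ = 𝔰𝔭(V_ℂ, ψ_ℂ)`, or `𝔥_ℂ` is simple with a minimal raising tripotent of
rank EXACTLY `3`** (N11's `{3, 4}` with `4` removed by `WeightOnePeirce.false_of_minimal_rank_four`).
[cite: MoonenZarhin1999LowDim, §2 (2.3)–(2.5) and §3 (3.1)] [cite: Ribet1983, Thm. 3] -/
theorem rankTwelve_sp_or_simple_three (H : HodgeStructure V n) (hn : n = 1) (heff : H.IsEffective)
    (ψ : H.Polarization) (hE : ∀ a ∈ H.endAlg, ∃ x : ℚ, a = x • (1 : Module.End ℚ V)) (hV : Module.finrank ℚ V = 12) :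
    (∀ Y : Module.End ℂ (ℂ ⊗[ℚ] V),
        (∀ x y, ψ.form.baseChange ℂ (Y x) y + ψ.form.baseChange ℂ x (Y y) = 0) → Y ∈ H.hodgeLieC) ∨
      ((∃ B C : Module.End ℂ (ℂ ⊗[ℚ] V), B ∈ H.hodgeLieC ∧ B ≠ 0 ∧ (∀ p ∈ H.piece 1 0, B p = 0) ∧
          (∀ v, B v ∈ H.piece 1 0) ∧ (∀ v, C v = conj (B (conj v))) ∧
          (∀ B' ∈ H.hodgeLieC, B' ≠ 0 → (∀ p ∈ H.piece 1 0, B' p = 0) → (∀ v, B' v ∈ H.piece 1 0) →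
            Module.finrank ℂ (LinearMap.range B) ≤ Module.finrank ℂ (LinearMap.range B')) ∧
          Module.finrank ℂ (LinearMap.range B) = 3) ∧
        ∀ T : Submodule ℂ (Module.End ℂ (ℂ ⊗[ℚ] V)), T ≤ H.hodgeLieC → T ≠ ⊥ →
          (∀ Y ∈ H.hodgeLieC, ∀ t ∈ T, Y * t - t * Y ∈ T) → T = H.hodgeLieC) := by
  classical
  rcases rankTwelve_sp_or_simple_three_four H hn heff ψ hE hV with
    h | ⟨⟨B, C, hB, hB0, hBP, hBim, hC, hmin, h3, h4⟩, hsimple⟩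
  · exact Or.inl h
  · right
    refine ⟨⟨B, C, hB, hB0, hBP, hBim, hC, hmin, ?_⟩, hsimple⟩
    rcases (show Module.finrank ℂ (LinearMap.range B) = 3 ∨ Module.finrank ℂ (LinearMap.range B) = 4 by omega) with
      h3' | h4'
    · exact h3'
    · exact (WeightOnePeirce.false_of_minimal_rank_four H ψ hn heff hE hV hsimple hB hB0 hBP hBim hC hmin h4').elim

set_option maxHeartbeats 1600000 in
/-- **Rank twelve, `End_Hdg = ℚ`: either `Lie Hg ⊗ ℂ = 𝔰𝔭₁₂`, or `𝔥_ℂ` is simple and the Levi involution algebra of a minimal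
raising tripotent is a PROPER bracket-closed, unital, irreducible subspace of `End(V^{1,0})` (`dim V^{1,0} = 6`) containing an
involution of type `3|3`** — the residual crux of the rank-twelve programme after the `r = 4` kill (the `3|3` square).
[cite: MoonenZarhin1999LowDim, §2 (2.3)–(2.5) and §3 (3.1)] [cite: Ribet1983, Thm. 3] [cite: Deligne1982HodgeCycles, I §3] -/
theorem rankTwelve_sp_or_leviCore33 (H : HodgeStructure V n) (hn : n = 1) (heff : H.IsEffective) (ψ : H.Polarization)
    (hE : ∀ a ∈ H.endAlg, ∃ x : ℚ, a = x • (1 : Module.End ℚ V)) (hV : Module.finrank ℚ V = 12) :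
    (∀ Y : Module.End ℂ (ℂ ⊗[ℚ] V),
        (∀ x y, ψ.form.baseChange ℂ (Y x) y + ψ.form.baseChange ℂ x (Y y) = 0) → Y ∈ H.hodgeLieC) ∨
      ((∀ T : Submodule ℂ (Module.End ℂ (ℂ ⊗[ℚ] V)), T ≤ H.hodgeLieC → T ≠ ⊥ →
          (∀ Y ∈ H.hodgeLieC, ∀ t ∈ T, Y * t - t * Y ∈ T) → T = H.hodgeLieC) ∧
        Module.finrank ℂ (H.piece 1 0) = 6 ∧
        ∃ (𝔏 : Submodule ℂ (Module.End ℂ ↥(H.piece 1 0))) (T : Module.End ℂ ↥(H.piece 1 0))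
          (PT QT : Submodule ℂ ↥(H.piece 1 0)),
          (∀ A, A ∈ 𝔏 ↔ ∃ Z ∈ H.hodgeLieC, ∀ p : ↥(H.piece 1 0), ((A p : ↥(H.piece 1 0)) : ℂ ⊗[ℚ] V) = Z p) ∧
          (∀ A ∈ 𝔏, ∀ A' ∈ 𝔏, A * A' - A' * A ∈ 𝔏) ∧ (1 : Module.End ℂ ↥(H.piece 1 0)) ∈ 𝔏 ∧
          (∀ U₀ : Submodule ℂ ↥(H.piece 1 0), (∀ A ∈ 𝔏, ∀ u ∈ U₀, A u ∈ U₀) → U₀ = ⊥ ∨ U₀ = ⊤) ∧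
          T ∈ 𝔏 ∧ T * T = 1 ∧ (∀ x, x ∈ PT ↔ T x = x) ∧ (∀ x, x ∈ QT ↔ T x = -x) ∧
          Module.finrank ℂ QT = 3 ∧ Module.finrank ℂ PT + Module.finrank ℂ QT = 6 ∧ 𝔏 ≠ ⊤) := by
  classical
  rcases rankTwelve_sp_or_simple_three H hn heff ψ hE hV with
    h | ⟨⟨B, C, hB, hB0, hBP, hBim, hC, hmin, h3⟩, hsimple⟩
  · exact Or.inl h
  · right
    obtain ⟨hbr, hskew, -, Θ, hΘ, hΘ𝔤⟩ := hodgeLie_standing H ψ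
    have hspan : H.hodgeLieC = spanC H.hodgeLie := hodgeLieC_eq_spanC H
    have hΘC : Θ ∈ H.hodgeLieC := by rw [hspan]; exact hΘ𝔤
    have hbrC : ∀ Y ∈ H.hodgeLieC, ∀ Z ∈ H.hodgeLieC, Y * Z - Z * Y ∈ H.hodgeLieC := fun Y hY Z hZ => by
      rw [hspan] at hY hZ ⊢
      exact commutator_mem_spanC hbr hY hZ
    have hirr : ∀ U : Submodule ℂ (ℂ ⊗[ℚ] V), (∀ Z ∈ H.hodgeLieC, ∀ u ∈ U, Z u ∈ U) → U = ⊥ ∨ U = ⊤ :=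
      fun U hU => SymplecticTheta.eq_bot_or_top_of_stable H hn heff ψ hE H.hodgeLie hΘ hΘ𝔤 hskew
        fun X hX u hu => hU _ (by rw [hspan]; exact baseChange_mem_spanC hX) u hu
    have hC𝔊 : C ∈ H.hodgeLieC := by
      rw [hspan] at hB ⊢
      exact conjOp_mem_spanC hB hC
    obtain ⟨hP6, -⟩ := finrank_pieces_eq_of_weightOne H hn heff (m := 6) (by rw [hV]) hΘ
    obtain ⟨𝔏, T, PT, QT, hmem𝔏, h𝔏br, h𝔏one, h𝔏irr, hT𝔏, hTT, hPT, hQT, -, hfinQT, hsum⟩ :=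
      WeightOnePeirce.exists_leviInvolutionAlgebra H ψ hn heff hΘ le_rfl hbrC hΘC hirr hB hB0 hBP hBim hC hC𝔊 hmin
    have hne : 𝔏 ≠ ⊤ :=
      WeightOnePeirce.leviAlgebra_ne_top H ψ hn heff hE hBim hmin (by omega) (𝔏 := 𝔏) fun A hA => (hmem𝔏 A).1 hA
    exact ⟨hsimple, hP6, 𝔏, T, PT, QT, hmem𝔏, h𝔏br, h𝔏one, h𝔏irr, hT𝔏, hTT, hPT, hQT, by omega, by omega, hne⟩

end HodgeStructure

end Literature.AlgebraicGeometry.Motives
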